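import Summits.MatrixMultiplication.MatrixMultiplication.Theorems.SaturationLadderTwinRestriction
import Summits.MatrixMultiplication.MatrixMultiplication.Theorems.SaturationLadderTwinDiagonal
import Literature.Computability.AlgebraicComplexity.RectangularExponentSubadditivity
import HarnessLib

/-!
# SaturationLadder — twin rung, the level-1 twin laser method as ONE real inequality

Route `SaturationLadder` (sub-problem `MatrixMultiplication`), support for the aside
`TwinSaturation` (stmt-MatrixMultiplication-30539).  Assembly of the tensor layer
(`Theorems/SaturationLadderTwinRestriction.lean`: `twChain`, `omegaRect_tw_le_of_card`, over
`R̃(TW_b) ≤ 2b+3` of `Theorems/SaturationLadderTwinCW.lean`) with the combinatorial layer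
(`Theorems/SaturationLadderTwinDiagonal.lean`: `twDiagonal`).  RESULT (`omegaRect_tw_le_of_count`):
for `b = 2^j` and counts `n₁, n₂, n₃, n₅, n₆` of the letters `(1,1,0), (0,1,1), (1,0,1), (2,0,0), (0,0,2)`,
`N = n₁ + n₂ + n₃ + n₅ + n₆ ≥ 1`, and any real `e` with

  `(2^{j+1} + 3)^N · (N+1)^63 · 192 · exp(4 √(log 6 + N log 27)) ≤ 2^{N · min(H(X), H(Y), H(Z)) + e}`,
  `X = (n₂+n₆, n₁+n₃, n₅)/N`, `Y = (n₃+n₅+n₆, n₁+n₂, 0)/N`, `Z = (n₁+n₅, n₂+n₃, n₆)/N`,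

one has **`ω(j n₁, (j+1) n₂ + n₁, (j+1) n₃ + n₅) ≤ e`**, and (`omegaRect_one_tw_le`, homogeneity,
Lotti–Romani 1983) **`ω(1, ((j+1) n₂ + n₁)/(j n₁), ((j+1) n₃ + n₅)/(j n₁)) ≤ e/(j n₁)`**.  This is the
complete first-power laser method on the twin tensor with the linear identification of the quadratic
letter, reduced to a single explicit inequality between elementary functions of six naturals and one
real: the rung `TwinSaturation` (`∃ C, ∀ t < 1, ∃ r ≤ C · 3^{1/(1−t)}, ω(1,t,r) ≤ 1 + r`) now needs only
the real-analysis verification of this inequality along the cell's closed-form families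
(`(η, κ) = (1, 17/20)`, `β ≥ 64`; evidence `twin-family-tables-g8.txt` on the item) plus
`omegaRect_mono'` / `expSaturation_holds` below the threshold — no further tensor or counting argument.

References: Coppersmith–Winograd 1990 §6–8 [CoppersmithWinograd1990]; Le Gall 2014 App. A
[LeGall2014]; Alman–Duan–Vassilevska Williams–Xu–Xu–Zhou 2025 Thm. 3.2
[AlmanDuanVassilevskaWilliamsXuXuZhou2025]; Lotti–Romani 1983 [LottiRomani1983].
No new definitions, no named facts, no sorry.
-/

set_option linter.dupNamespace false
-- (single-conjunct summit: the namespace repeats `MatrixMultiplication`)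

noncomputable section

open Finset
open scoped BigOperators

namespace Summit.MatrixMultiplication.MatrixMultiplication.Theorems.SaturationLadderTwinPipeline

open Literature.Computability.AlgebraicComplexity
open Summit.MatrixMultiplication.MatrixMultiplication.Theorems.SaturationLadderTwinRestriction
  (omegaRect_tw_le_of_card)
open Summit.MatrixMultiplication.MatrixMultiplication.Theorems.SaturationLadderTwinDiagonal
  (twDiagonal)

/-- **The level-1 twin laser method as one inequality.**  If
`(2^{j+1}+3)^N · (N+1)^63 · 192 · exp(4 √(log 6 + N log 27)) ≤ 2^{N · min(H X, H Y, H Z) + e}`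
for the five-letter type `(n₁, n₂, n₃, n₅, n₆)`, then `ω(j n₁, (j+1) n₂ + n₁, (j+1) n₃ + n₅) ≤ e`.
[cite: AlmanDuanVassilevskaWilliamsXuXuZhou2025, Thm. 3.2] [cite: LeGall2014, Appendix A.3] -/
theorem omegaRect_tw_le_of_count (j n₁ n₂ n₃ n₅ n₆ : ℕ) (hN : 0 < n₁ + n₂ + n₃ + n₅ + n₆) (e : ℝ)
    (hcount : ((2 : ℝ) ^ (j + 1) + 3) ^ (n₁ + n₂ + n₃ + n₅ + n₆) *
        ((((((n₁ + n₂ + n₃ + n₅ + n₆ : ℕ)) : ℝ)) + 1) ^ 63 * 192 *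
          Real.exp (4 * Real.sqrt (Real.log 6 +
            (((n₁ + n₂ + n₃ + n₅ + n₆ : ℕ)) : ℝ) * Real.log 27))) ≤
      (2 : ℝ) ^ ((((n₁ + n₂ + n₃ + n₅ + n₆ : ℕ)) : ℝ) *
          min (shannonEntropy ![((n₂ : ℝ) + n₆) / (n₁ + n₂ + n₃ + n₅ + n₆ : ℕ),
              ((n₁ : ℝ) + n₃) / (n₁ + n₂ + n₃ + n₅ + n₆ : ℕ), (n₅ : ℝ) / (n₁ + n₂ + n₃ + n₅ + n₆ : ℕ)])
            (min (shannonEntropy ![((n₃ : ℝ) + n₅ + n₆) / (n₁ + n₂ + n₃ + n₅ + n₆ : ℕ),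
              ((n₁ : ℝ) + n₂) / (n₁ + n₂ + n₃ + n₅ + n₆ : ℕ), 0])
              (shannonEntropy ![((n₁ : ℝ) + n₅) / (n₁ + n₂ + n₃ + n₅ + n₆ : ℕ),
                ((n₂ : ℝ) + n₃) / (n₁ + n₂ + n₃ + n₅ + n₆ : ℕ),
                (n₆ : ℝ) / (n₁ + n₂ + n₃ + n₅ + n₆ : ℕ)])) + e)) :
    omegaRect ℂ ((j : ℝ) * n₁) (((j : ℝ) + 1) * n₂ + n₁) (((j : ℝ) + 1) * n₃ + n₅) ≤ e := by
  obtain ⟨Δ, hS, hcnt, hfree, hsize⟩ := twDiagonal n₁ n₂ n₃ n₅ n₆ hN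
  -- `Δ` is non-empty
  have hV : 1 ≤ Δ.card := by
    by_contra h0
    have h0' : Δ.card = 0 := by omega
    rw [h0', Nat.cast_zero, zero_mul, zero_mul, zero_mul] at hsize
    exact absurd hsize (not_le.2 (by positivity))
  -- `(2^{j+1}+3)^N ≤ |Δ| · 2^e`
  have hcard : ((2 : ℝ) ^ (j + 1) + 3) ^ (n₁ + n₂ + n₃ + n₅ + n₆) ≤ (Δ.card : ℝ) * (2 : ℝ) ^ e := by
    rw [Real.rpow_add (by norm_num : (0 : ℝ) < 2)] at hcount
    have hJ0 : (0 : ℝ) < ((((((n₁ + n₂ + n₃ + n₅ + n₆ : ℕ)) : ℝ)) + 1) ^ 63 * 192 *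
        Real.exp (4 * Real.sqrt (Real.log 6 +
          (((n₁ + n₂ + n₃ + n₅ + n₆ : ℕ)) : ℝ) * Real.log 27))) := by positivity
    have h2e : (0 : ℝ) ≤ (2 : ℝ) ^ e := by positivity
    nlinarith [hcount, hJ0, h2e, mul_le_mul_of_nonneg_right hsize h2e]
  have h := omegaRect_tw_le_of_card j n₁ n₂ n₃ 0 n₅ (n₁ + n₂ + n₃ + n₅ + n₆) hN Δ hS hcnt hfree hV
    e hcard
  rw [Nat.cast_zero, add_zero] at h
  exact h

/-- **Homogeneous form**: under the same count condition, for `j, n₁ ≥ 1`,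
`ω(1, ((j+1) n₂ + n₁)/(j n₁), ((j+1) n₃ + n₅)/(j n₁)) ≤ e/(j n₁)` (`ω(νx, νy, νz) = ν ω(x,y,z)`,
Lotti–Romani 1983). [cite: LottiRomani1983, §1 (p. 173)] -/
theorem omegaRect_one_tw_le (j n₁ n₂ n₃ n₅ n₆ : ℕ) (hj : 0 < j) (hn₁ : 0 < n₁) (e : ℝ)
    (hcount : ((2 : ℝ) ^ (j + 1) + 3) ^ (n₁ + n₂ + n₃ + n₅ + n₆) *
        ((((((n₁ + n₂ + n₃ + n₅ + n₆ : ℕ)) : ℝ)) + 1) ^ 63 * 192 *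
          Real.exp (4 * Real.sqrt (Real.log 6 +
            (((n₁ + n₂ + n₃ + n₅ + n₆ : ℕ)) : ℝ) * Real.log 27))) ≤
      (2 : ℝ) ^ ((((n₁ + n₂ + n₃ + n₅ + n₆ : ℕ)) : ℝ) *
          min (shannonEntropy ![((n₂ : ℝ) + n₆) / (n₁ + n₂ + n₃ + n₅ + n₆ : ℕ),
              ((n₁ : ℝ) + n₃) / (n₁ + n₂ + n₃ + n₅ + n₆ : ℕ), (n₅ : ℝ) / (n₁ + n₂ + n₃ + n₅ + n₆ : ℕ)])
            (min (shannonEntropy ![((n₃ : ℝ) + n₅ + n₆) / (n₁ + n₂ + n₃ + n₅ + n₆ : ℕ),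
              ((n₁ : ℝ) + n₂) / (n₁ + n₂ + n₃ + n₅ + n₆ : ℕ), 0])
              (shannonEntropy ![((n₁ : ℝ) + n₅) / (n₁ + n₂ + n₃ + n₅ + n₆ : ℕ),
                ((n₂ : ℝ) + n₃) / (n₁ + n₂ + n₃ + n₅ + n₆ : ℕ),
                (n₆ : ℝ) / (n₁ + n₂ + n₃ + n₅ + n₆ : ℕ)])) + e)) :
    omegaRect ℂ 1 ((((j : ℝ) + 1) * n₂ + n₁) / ((j : ℝ) * n₁))
        ((((j : ℝ) + 1) * n₃ + n₅) / ((j : ℝ) * n₁)) ≤ e / ((j : ℝ) * n₁) := by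
  have hN : 0 < n₁ + n₂ + n₃ + n₅ + n₆ := by omega
  have h := omegaRect_tw_le_of_count j n₁ n₂ n₃ n₅ n₆ hN e hcount
  have hν : (0 : ℝ) < (j : ℝ) * n₁ := by
    have hj' : (0 : ℝ) < j := by exact_mod_cast hj
    have hn' : (0 : ℝ) < n₁ := by exact_mod_cast hn₁
    exact mul_pos hj' hn'
  have hhom := LottiRomani1983_homogeneous ℂ hν.le zero_le_one
    (by positivity : (0 : ℝ) ≤ (((j : ℝ) + 1) * n₂ + n₁) / ((j : ℝ) * n₁))
    (by positivity : (0 : ℝ) ≤ (((j : ℝ) + 1) * n₃ + n₅) / ((j : ℝ) * n₁))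
  rw [mul_one, mul_div_cancel₀ _ hν.ne', mul_div_cancel₀ _ hν.ne'] at hhom
  rw [hhom] at h
  rw [le_div_iff₀ hν]
  linarith

end Summit.MatrixMultiplication.MatrixMultiplication.Theorems.SaturationLadderTwinPipeline

end
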